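import Literature.MathematicalPhysics.QuantumFieldTheory.Balaban1983to89.B9Eq382V3Operator
import Mathlib.Analysis.Normed.Algebra.TrivSqZeroExt

/-!
# `Balaban1983to89.B9Eq382V3NormAnalytic` — B9, p. 407, after (3.82)/(3.83): «The operators V₃(A), P₁(A), P₂(A) depend analytically
# on A in the domain (3.37)» FOR `V₃(A)` — and for `V₁(A)`, `V₂(A)`, `Δ′(U′U)`, `D*_{U′U}D_{U′U}`, `D_{U′U}D*_{U′U}`, `Δ(U′U)`,
# `(Δ + η⁻²DD*)(U′U)` — IN THE OPERATOR NORM of `𝓛(field space)`, by change of coefficient algebra (naturality of every gadget of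
# the lineage) and a square-zero extension device; v1

CITATION HEADER (lean-in-tree rule).  Audit cell `pub-balaban`, surge node-prover lineage pv27 (B9 pp. 390–392, 395–397, 404–407),
unit `b2b-balaban-pv27-g20` (journal CLAIM l.1112 of the post-rotation `CLAIMS.log`, node B9-EQ382-V3-NORM-ANALYTIC; fourth node of
the seat, after `B9Eq373V3` (p193995), `B9Eq373V3Analytic` (p194222) and `B9Eq382V3Operator` (p194384), which is imported BY NAME and
brings the whole chain `B9Eq39Adjoint` … `B9Eq373V3Analytic`; nothing of them is restated).  Source: T. Bałaban, *Propagators for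
lattice gauge theories in a background field*, Commun. Math. Phys. **99** (1985) 389–434 [Balaban1985BackgroundPropagators] (cell paper
B9; journal page = PDF page + 388), p. 407 [PDF 19] (the paragraph after (3.82)/(3.83)) and p. 396 [PDF 8] ((3.37)), quoted from the page
renders `b2b-balaban-ref1/pages/1985-cmp99-background-propagators/…-p019-x4.png`, `…-p008-x4.png` READ AS IMAGES by this seat
(2026-08-19), and the lineage's transcriptions of (3.6)–(3.10), (3.71), (3.75), (3.82) in the imported leaves.

HONEST FRAMING (cell charter, verbatim in substance).  The cell audits Bałaban's papers; discharging its end statements would make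
Bałaban's ultraviolet stability theorem unconditional inside this package — a constructive-QFT statement; it is NOT the continuum
limit and NOT the Clay problem.  THIS FILE DISCHARGES NOTHING of the series.  It upgrades one reading: `B9Eq382V3Operator` proved the
analyticity sentence for `V₃` as STRONG analyticity (`A ↦ V₃(A)A′` entire for each test field `A′`) and listed analyticity IN OPERATOR
NORM under NOT PROVED («on a finite lattice over an infinite-dimensional `𝔸` the two are not formally identified here»).  Here the
operator-norm statement is PROVED, for `V₃(A)` and for every operator family of (3.71)/(3.75)/(3.82) the lineage has packaged, over an
ARBITRARY complete complex normed algebra `𝔸` and a finite lattice — by an algebraic device, not by an estimate: no constant of the paper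
is touched and no bound is claimed.

THE METHOD (a proof device; no physics content).  (i) NATURALITY.  Every gadget `Γ(U)(A)(A′)(b)` of the lineage entering `V₃` — parallel
transporters `R`, covariant derivatives (3.6)/(3.8), curls (3.7), plaquette variables, the weights `z(p)`, `y(p)` and the letter sums of
`Δ′` (3.10), `D*D` (3.71), `DD*` (3.75), `U′U = e^{iηA}U`, `V₁`, `V₂`, `V₃` — is a polynomial (for `U′U`: a norm-convergent exponential
series) in the configuration and the exponent field and is LINEAR in the test field; hence for an algebra homomorphism `ψ : B → B′`
(continuous where `exp` occurs) and a `ψ`-two-sided linear `χ` (`χ(ts) = ψ(t)χ(s)`, `χ(st) = χ(s)ψ(t)`) one has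
`Γ(ψU)(ψA)(χA′) = χ(Γ(U)(A)(A′))` (§1, some thirty `simp only` lemmas over the lineage's DEFINITIONS, each pulled back to one `χ(…)`).
(ii) THE SQUARE-ZERO DEVICE.  Let `𝔹 := 𝔸 ⋉ End(𝔸)` be the trivial square-zero extension of `𝔸` by the `𝔸`-bimodule `End(𝔸) = (𝔸 →L[ℂ] 𝔸)`
(`(c ▹ m)(a) = c·m(a)`, `(m ◃ c)(a) = m(a)·c`; Mathlib's `TrivSqZeroExt` with the ℓ¹ norm — a complete complex normed algebra; the two
bounded-action facts it needs are proved here and used as LOCAL instances only).  For `a ∈ 𝔸`, evaluation `Ψ_a : 𝔹 → 𝔸[ε]`,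
`(c, m) ↦ (c, m(a))`, is a continuous algebra homomorphism, and `(inl, inr) : 𝔸 → 𝔸[ε]` is a two-sided pair.  With the UNIVERSAL TEST
FIELD `Ξ_{κz} := (0, δ_{κz}·id_𝔸) ∈ 𝔹`-fields, naturality along `Ψ_a` and along `(inl, inr)` gives the MATRIX-ENTRY FORMULA
`snd(Γ^{𝔹}(inl U)(inl A)(Ξ_{κz})(μx))(a) = Γ^{𝔸}(U)(A)(δ_{κz}a)(μx)` (`snd_apply_eq_of_natural`): the `End(𝔸)`-valued matrix entries of
the operator `Γ^{𝔸}(U)(A)` ARE values of the `𝔹`-version of the same gadget.  The lineage proved `A ↦ Γ(U)(A)(A′)(b)` analytic over EVERY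
complete complex normed algebra (`B9Eq373V3Analytic`), in particular over `𝔹`; so each matrix entry is analytic in the norm of `End(𝔸)`,
and on a finite lattice `Γ(U)(A) = Σ_{κz,μx} δ_{μx} ∘ entry_{μx,κz}(A) ∘ ev_{κz}` is a finite sum of compositions with fixed continuous
linear maps — analytic in `𝓛(field space)` with its operator norm (`analyticOnNhd_opNorm_of_device`).  (Dual-number jets appear in the
tree in `Beta/AveragingThirdJet` for a different purpose — truncated Taylor jets of the averaging maps; nothing of it is used or restated.)

ABSOLUTE RULE honoured: no programme-internal statement is cited; Mathlib (`TrivSqZeroExt` with its algebra/norm/topology,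
`TrivSqZeroExt.lift`, `map_exp_of_mem_ball`, `ContinuousLinearMap.analyticAt`, `ContinuousLinearMap.compL`, `Finset.analyticAt_fun_sum`)
and the lineage's definitions and theorems are used BY NAME; every theorem below is kernel-checked.  `P(U)`, `P′(A)`, `P₁(A)` ((3.68),
(3.76), (3.77)) and `P₂(A)` ((3.83)) — lanes r1/b10 — are NOT touched; the sentence is proved for `V₃` (and the differential families
behind it) only.

LETTERS AND NORMALISATION (as in the lineage).  `𝔸` a complete normed ℂ-algebra, sites `S` and directions `ι` FINITE, shifts `T`,
background `U : ι → S → 𝔸ˣ` (arbitrary units), exponent field `A`, `U′U = prodCfg U η A`, test field `A′`, field space `ι → S → 𝔸` with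
the Pi sup norm ((3.39)), `𝓛(field space) = (ι → S → 𝔸) →L[ℂ] (ι → S → 𝔸)` with the operator norm; `V₁L`, `V₂L`, `lapDDL`, `gradDivL`
(`B9Eq372Operator`, `η²`-scaled), `deltaPrimeL`, `deltaL`, `dSumL`, `V₃L` (`B9Eq382V3Operator`, printed scale).  In §1 the coefficient
algebras `B`, `B′` are arbitrary complex normed algebras (complete where `U′U` occurs).

WHAT IS IN PRINT (verbatim).  p. 407 [PDF 19]: «… = Δ_a(U) − V₃(A) − P₁(A) − P₂(A). (3.82) The operator V₃(A) is a local differential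
operator of the first order satisfying the bound (3.73). […] The operators V₃(A), P₁(A), P₂(A) depend analytically on A in the domain
(3.37).»  p. 396 [PDF 8]: «… for complex A satisfying |A| < α₁(L^jη)⁻¹, |∇A| < α₁(L^jη)⁻² on Ω_j … (3.37)» (the lineage's `dom337`).
The print does not say in which topology «depend analytically» is meant; on the finite lattice this file proves the strongest one.

WHAT THIS FILE PROVES (all [folklore]):
* §1 NATURALITY (arbitrary complex normed algebras `B → B′`, `ψ` an algebra hom, `χ` `ψ`-two-sided): **`mapCfg`** (`ψU`; private
  helpers: `map_exp_of_continuous`, the pull rules, `self_left/right`), and, under the hypotheses `hl`/`hr` (`χ` `ψ`-two-sided), `Γ(ψU)(ψA)(χA′) = χ(Γ(U)(A)(A′))` for `Γ =` `R` (`R_map`), `D` (`covD_map`), `D*`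
  (`covDstar_map`), curl (`curl_map`), `U(∂p)` (`plaqU_map`), `Re`/`Im` (`reC_map`, `imC_map`), `z(p)`, `y(p)` (`zP_map`, `yP_map`), the
  Jordan and commutator letters and sign sums of `Δ′` (`jordanF_map`, `sgnSumᵢ_map`, `commGᵢ_map_fun`), the plaquette and letter
  divergences (`divP_map`, `divL_map`), **`deltaPrimeOp_map`** (`Δ′`), **`lapDD_map`** (`D*D`), **`gradDiv_map`** (`DD*`), **`prodCfg_map`**
  (`ψ(e^{iηA}U) = e^{iηψA}ψU`, continuous `ψ`), `deltaPrimeOp_prodCfg_map`, `lapDD_prodCfg_map`, `gradDiv_prodCfg_map`, **`V₁op_map`**,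
  **`V₂op_map`**, **`V₃val_map`**.
* §2 THE DEVICE (`𝔹 = TrivSqZeroExt 𝔸 (𝔸 →L[ℂ] 𝔸)`, `𝔻 = TrivSqZeroExt 𝔸 𝔸`): the defs `inlL`, `sndL`, `inrD`, `evalInr`, **`Ψ a : 𝔹 →ₐ[ℂ] 𝔻`**,
  `inlFL`, `projL`, **`Ξ κ z`**, `embedL` (private helpers: `norm_smul_End_le`, `norm_op_smul_End_le`, `isBoundedSMul_End(_op)` — LOCAL
  instances —, `Ψ_apply`, `Ψ_inl`, `Ψ_inr`, `snd_Ψ`, `continuous_Ψ`, `inl_inr_left/right`, `mapCfg_Ψ`, `Ψ_Ξ`, `sum_single_single`, …),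
  **`snd_apply_eq_of_natural`** (the matrix-entry formula), **`analyticOnNhd_opNorm_of_device`**.
* §3 OPERATOR-NORM ANALYTICITY on a finite lattice over a complete complex normed algebra, each as `AnalyticOnNhd ℂ (A ↦ ·) univ` with
  values in `𝓛(field space)`: **`analyticOnNhd_V₃L`** (`V₃(A)`), **`analyticOnNhd_V₁L`**, **`analyticOnNhd_V₂L`**,
  **`analyticOnNhd_deltaPrimeL_prodCfg`** (`Δ′(U′U)`), **`analyticOnNhd_lapDDL_prodCfg`** (`D*_{U′U}D_{U′U}`), **`analyticOnNhd_gradDivL_prodCfg`**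
  (`D_{U′U}D*_{U′U}`), **`analyticOnNhd_deltaL_prodCfg`** (`Δ(U′U)`), **`analyticOnNhd_dSumL_prodCfg`** (`(Δ + η⁻²DD*)(U′U)`, via `eq382_V₃`);
  the printed sentence's domain: **`analyticOnNhd_V₃L_dom337`**; corollaries `differentiable_V₃L`, `continuous_V₃L` (operator-norm
  continuity), `analyticOnNhd_V₃L_entry` (each `End(𝔸)`-valued matrix entry is entire).
* §4 SANITY (`example`s): differentiability at `A = 0`; `mapCfg id = id`; the instances `NormedAlgebra ℂ 𝔹`, `CompleteSpace 𝔹` are Mathlib's.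

RELATED IN THE TREE, NOT DUPLICATED (searched 2026-08-19: MODULE-MAP rows B9; `grep -rn "TrivSqZeroExt\|Units.map\|AnalyticOnNhd" Balaban1983to89/`):
`B9Eq382V3Operator` (strong analyticity `analyticOnNhd_V₃L_apply`, `_joint`; the operators — imported and USED), `B9Eq373V3Analytic`
(bondwise analyticity of `lapDD`/`gradDiv`/`V₁op`/`V₂op`/`deltaPrimeOp`/`V₃val` in `A` over any complete normed algebra, `dom337` — USED, over
`𝔹`), `B9Eq372Operator` (strong analyticity of `V₁`, `V₂`), `B9Eq369Small`/`B9Eq37Insertion` (analyticity of scalar insertions); no leaf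
states a naturality/change-of-coefficients lemma for the B9 §3 gadgets or an operator-norm analyticity statement.

NOT PROVED HERE, NOT CLAIMED: anything about `P₁(A)`, `P₂(A)` (the other two operators of the sentence — lanes r1/b10); (3.84)–(3.86);
bounds of any kind (the operator-norm BOUND (3.73) is `B9Eq382V3Operator.opNorm_V₃L_le`; no Cauchy estimate on derivatives is drawn
here); `Ω_j`-localisation beyond restricting the entire statement to `dom337`; Hermitian symmetry.  The device gives analyticity on ALL
of field space (the maps are entire on a finite lattice); the print's restriction to (3.37) matters for the BOUNDS, not for analyticity.
Records: GAPS C-pv27-83 (no divergence).  NOT summit progress.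
-/

noncomputable section

namespace Literature.MathematicalPhysics.QuantumFieldTheory.Balaban1983to89.B9Eq382V3NormAnalytic

open Complex NormedSpace
open Literature.MathematicalPhysics.QuantumFieldTheory.Balaban1983to89
open Literature.MathematicalPhysics.QuantumFieldTheory.Balaban1983to89.B9Eq37Insertion
open Literature.MathematicalPhysics.QuantumFieldTheory.Balaban1983to89.B9Eq39Adjoint
open Literature.MathematicalPhysics.QuantumFieldTheory.Balaban1983to89.B9Eq310Hermitian
open Literature.MathematicalPhysics.QuantumFieldTheory.Balaban1983to89.B9Eq369Product
open Literature.MathematicalPhysics.QuantumFieldTheory.Balaban1983to89.B9Eq371Composition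
open Literature.MathematicalPhysics.QuantumFieldTheory.Balaban1983to89.B9Eq375Composition
open Literature.MathematicalPhysics.QuantumFieldTheory.Balaban1983to89.B9Eq372Operator
open Literature.MathematicalPhysics.QuantumFieldTheory.Balaban1983to89.B9Eq386Neumann
open Literature.MathematicalPhysics.QuantumFieldTheory.Balaban1983to89.B9Eq373V3
open Literature.MathematicalPhysics.QuantumFieldTheory.Balaban1983to89.B9Eq373V3Analytic
open Literature.MathematicalPhysics.QuantumFieldTheory.Balaban1983to89.B9Eq382V3Operator

/-! ## §1 Change of coefficients: naturality of the lineage gadgets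

Throughout §1, `ψ : B →ₐ[ℂ] B′` is an algebra homomorphism of complex normed algebras and `χ : B →ₗ[ℂ] B′` a linear map that is
`ψ`-TWO-SIDED, `χ(ts) = ψ(t)χ(s)`, `χ(st) = χ(s)ψ(t)` (hypotheses `hl`, `hr`).  Configurations are pushed through `ψ` (`mapCfg`), the field in the exponent of
`U′ = e^{iηA}` through `ψ`, and the TEST field through `χ`.  Every gadget `Γ` of the lineage entering `V₃` then satisfies
`Γ(ψU)(ψA)(χA′) = χ(Γ(U)(A)(A′))` — it is a polynomial (for `U′U`: an exponential series) expression, linear in the test field. -/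

section Natural

variable {B : Type*} [NormedRing B] [NormedAlgebra ℂ B]
variable {B' : Type*} [NormedRing B'] [NormedAlgebra ℂ B']
variable {S ι : Type*} (T : ι → Equiv.Perm S)
variable (ψ : B →ₐ[ℂ] B') (χ : B →ₗ[ℂ] B')

/-- A continuous ring homomorphism of complete complex normed algebras commutes with the exponential (Mathlib's `map_exp` is stated
for `ℚ`-algebras; this is `map_exp_of_mem_ball` with the infinite radius of `expSeries` over `ℂ`). [folklore] -/
private theorem map_exp_of_continuous [CompleteSpace B] {F : Type*} [FunLike F B B'] [RingHomClass F B B'] (f : F)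
    (hf : Continuous f) (x : B) : f (exp x) = exp (f x) :=
  map_exp_of_mem_ball (𝕂 := ℂ) f hf x ((expSeries_radius_eq_top ℂ B).symm ▸ edist_lt_top _ _)

/-- A configuration pushed through `ψ`: `(ψU)(b′) = ψ(U(b′)) ∈ B′ˣ`. [folklore] -/
def mapCfg (V : ι → S → Bˣ) : ι → S → B'ˣ := fun κ z => Units.map (ψ : B →* B') (V κ z)

/-- [folklore] -/
@[simp] private theorem val_mapCfg (V : ι → S → Bˣ) (κ : ι) (z : S) : (mapCfg ψ V κ z : B') = ψ (V κ z) := by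
  simp [mapCfg]

/-- [folklore] -/
@[simp] private theorem val_inv_mapCfg (V : ι → S → Bˣ) (κ : ι) (z : S) :
    (((mapCfg ψ V κ z)⁻¹ : B'ˣ) : B') = ψ (((V κ z)⁻¹ : Bˣ) : B) := by
  simp [mapCfg]

/-- `(ψ, ψ)` is a two-sided pair (left). [folklore] -/
private theorem self_left : ∀ t s : B, ψ.toLinearMap (t * s) = ψ t * ψ.toLinearMap s := fun t s => by simp

/-- `(ψ, ψ)` is a two-sided pair (right). [folklore] -/
private theorem self_right : ∀ s t : B, ψ.toLinearMap (s * t) = ψ.toLinearMap s * ψ t := fun s t => by simp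

variable {ψ χ}

/-! ### "Pull" rules: every rule moves `ψ`/`χ` OUTWARD, so that `simp only` normalises a mapped expression to `χ(…)` / `ψ(…)`. -/

/-- [folklore] -/
private theorem mul_left_rev (hl : ∀ t s : B, χ (t * s) = ψ t * χ s) (t s : B) : ψ t * χ s = χ (t * s) := (hl t s).symm
/-- [folklore] -/
private theorem mul_right_rev (hr : ∀ s t : B, χ (s * t) = χ s * ψ t) (s t : B) : χ s * ψ t = χ (s * t) := (hr s t).symm
/-- [folklore] -/ private theorem hom_mul_rev (t s : B) : ψ t * ψ s = ψ (t * s) := (map_mul ψ t s).symm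
/-- [folklore] -/ private theorem hom_add_rev (t s : B) : ψ t + ψ s = ψ (t + s) := (map_add ψ t s).symm
/-- [folklore] -/ private theorem hom_sub_rev (t s : B) : ψ t - ψ s = ψ (t - s) := (map_sub ψ t s).symm
/-- [folklore] -/ private theorem hom_smul_rev (c : ℂ) (t : B) : c • ψ t = ψ (c • t) := (map_smul ψ c t).symm
/-- [folklore] -/ private theorem hom_one_rev : (1 : B') = ψ 1 := (map_one ψ).symm
/-- [folklore] -/ private theorem lin_add_rev (t s : B) : χ t + χ s = χ (t + s) := (map_add χ t s).symm
/-- [folklore] -/ private theorem lin_sub_rev (t s : B) : χ t - χ s = χ (t - s) := (map_sub χ t s).symm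
/-- [folklore] -/ private theorem lin_neg_rev (t : B) : -χ t = χ (-t) := (map_neg χ t).symm
/-- [folklore] -/ private theorem lin_smul_rev (c : ℂ) (t : B) : c • χ t = χ (c • t) := (map_smul χ c t).symm
/-- [folklore] -/
private theorem lin_sum_rev {X : Type*} (s : Finset X) (f : X → B) : ∑ i ∈ s, χ (f i) = χ (∑ i ∈ s, f i) :=
  (map_sum χ f s).symm
/-- [folklore] -/
private theorem lin_ite_rev (p : Prop) [Decidable p] (t : B) : (if p then χ t else 0) = χ (if p then t else 0) := by
  split_ifs <;> simp

/-! STANDING HYPOTHESES for the rest of §1: `χ` is `ψ`-TWO-SIDED, `χ(ts) = ψ(t)χ(s)` (`hl`) and `χ(st) = χ(s)ψ(t)` (`hr`).  Examples: `(ψ, ψ)`;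
`(inl, inr)` into a trivial square-zero extension (§2). -/
variable (hl : ∀ t s : B, χ (t * s) = ψ t * χ s) (hr : ∀ s t : B, χ (s * t) = χ s * ψ t)
include hl hr

/-- `R(ψW)(χX) = χ(R(W)X)`. [folklore] [cite: Balaban1985BackgroundPropagators, p.391] -/
theorem R_map (W : Bˣ) (X : B) : R (Units.map (ψ : B →* B') W) (χ X) = χ (R W X) := by
  simp only [R, Units.coe_map, Units.coe_map_inv, MonoidHom.coe_coe, mul_left_rev hl, mul_right_rev hr]

/-- The covariant derivative (3.6) is natural. [folklore] [cite: Balaban1985BackgroundPropagators, (3.6) p.391] -/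
theorem covD_map (V : ι → S → Bˣ) (κ : ι) (f : S → B) (z : S) :
    covD T (mapCfg ψ V) κ (fun y => χ (f y)) z = χ (covD T V κ f z) := by
  simp only [covD, mapCfg, R_map hl hr, lin_sub_rev]

/-- Its adjoint (3.8) is natural. [folklore] [cite: Balaban1985BackgroundPropagators, (3.8) p.392] -/
theorem covDstar_map (V : ι → S → Bˣ) (κ : ι) (f : S → B) (z : S) :
    covDstar T (mapCfg ψ V) κ (fun y => χ (f y)) z = χ (covDstar T V κ f z) := by
  simp only [covDstar, mapCfg, ← map_inv, R_map hl hr, lin_sub_rev]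

/-- … as functions of the site. [folklore] -/
private theorem covDstar_map_fun (V : ι → S → Bˣ) (κ : ι) (f : S → B) :
    covDstar T (mapCfg ψ V) κ (fun y => χ (f y)) = fun z => χ (covDstar T V κ f z) := funext (covDstar_map T hl hr V κ f)

/-- The curl (3.7) is natural. [folklore] [cite: Balaban1985BackgroundPropagators, (3.7) p.391] -/
theorem curl_map (V : ι → S → Bˣ) (A : ι → S → B) (μ ν : ι) (z : S) :
    curl T (mapCfg ψ V) (fun τ y => χ (A τ y)) μ ν z = χ (curl T V A μ ν z) := by
  simp only [curl, covD_map T hl hr, lin_sub_rev]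

/-- … as plaquette functions. [folklore] -/
private theorem curl_map_fun (V : ι → S → Bˣ) (A : ι → S → B) :
    curl T (mapCfg ψ V) (fun τ y => χ (A τ y)) = fun μ ν z => χ (curl T V A μ ν z) :=
  funext fun μ => funext fun ν => funext (curl_map T hl hr V A μ ν)

omit hl hr in
/-- Plaquette variables are natural: `(ψU)(∂p) = ψ(U(∂p))`. [folklore] [cite: Balaban1985BackgroundPropagators, p.391] -/
theorem plaqU_map (V : ι → S → Bˣ) (μ ν : ι) (z : S) :
    plaqU T (mapCfg ψ V) μ ν z = Units.map (ψ : B →* B') (plaqU T V μ ν z) := by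
  simp only [plaqU, mapCfg, map_mul, map_inv]

omit hl hr in
/-- `Re` of a pushed unit: `Re(ψW) = ψ(Re W)`. [folklore] [cite: Balaban1985BackgroundPropagators, (3.10) p.392] -/
theorem reC_map (W : Bˣ) : reC (Units.map (ψ : B →* B') W) = ψ (reC W) := by
  simp only [reC, Units.coe_map, Units.coe_map_inv, MonoidHom.coe_coe, hom_add_rev, hom_smul_rev]

omit hl hr in
/-- `Im` of a pushed unit: `Im(ψW) = ψ(Im W)`. [folklore] [cite: Balaban1985BackgroundPropagators, (3.10) p.392] -/
theorem imC_map (W : Bˣ) : imC (Units.map (ψ : B →* B') W) = ψ (imC W) := by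
  simp only [imC, Units.coe_map, Units.coe_map_inv, MonoidHom.coe_coe, hom_sub_rev, hom_smul_rev]

omit hl hr in
/-- The weight `z(p) = η⁻²(Re U(∂p) − 1)` is natural. [folklore] [cite: Balaban1985BackgroundPropagators, (3.10) p.392] -/
theorem zP_map (V : ι → S → Bˣ) (η : ℝ) (μ ν : ι) (z : S) : zP T (mapCfg ψ V) η μ ν z = ψ (zP T V η μ ν z) := by
  simp only [zP, plaqU_map, reC_map, hom_one_rev (ψ := ψ), hom_sub_rev, hom_smul_rev]

omit hl hr in
/-- The weight `y(p) = η⁻² Im U(∂p)` is natural. [folklore] [cite: Balaban1985BackgroundPropagators, (3.10) p.392] -/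
theorem yP_map (V : ι → S → Bˣ) (η : ℝ) (μ ν : ι) (z : S) : yP T (mapCfg ψ V) η μ ν z = ψ (yP T V η μ ν z) := by
  simp only [yP, plaqU_map, imC_map, hom_smul_rev]

/-- The Jordan-symmetrised first term of `Δ′` is natural. [folklore] [cite: Balaban1985BackgroundPropagators, (3.10) p.392] -/
theorem jordanF_map (V : ι → S → Bˣ) (η : ℝ) (A : ι → S → B) (μ ν : ι) (z : S) :
    jordanF T (mapCfg ψ V) η (fun τ y => χ (A τ y)) μ ν z = χ (jordanF T V η A μ ν z) := by
  simp only [jordanF, curl_map T hl hr, zP_map, mul_left_rev hl, mul_right_rev hr, lin_add_rev, lin_smul_rev]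

/-- … as plaquette functions. [folklore] -/
private theorem jordanF_map_fun (V : ι → S → Bˣ) (η : ℝ) (A : ι → S → B) :
    jordanF T (mapCfg ψ V) η (fun τ y => χ (A τ y)) = fun μ ν z => χ (jordanF T V η A μ ν z) :=
  funext fun μ => funext fun ν => funext (jordanF_map T hl hr V η A μ ν)

/-- The sign sums of `Δ′`'s commutator letters are natural (slot 1). [folklore] [cite: Balaban1985BackgroundPropagators, (3.10) p.392] -/
theorem sgnSum₁_map (V : ι → S → Bˣ) (A : ι → S → B) (μ ν : ι) (z : S) :
    sgnSum₁ T (mapCfg ψ V) (fun τ y => χ (A τ y)) μ ν z = χ (sgnSum₁ T V A μ ν z) := by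
  simp only [sgnSum₁, mapCfg, R_map hl hr, lin_add_rev, lin_neg_rev]

/-- Slot 2 of the sign sums. [folklore] [cite: Balaban1985BackgroundPropagators, (3.10) p.392] -/
theorem sgnSum₂_map (V : ι → S → Bˣ) (A : ι → S → B) (μ ν : ι) (z : S) :
    sgnSum₂ T (mapCfg ψ V) (fun τ y => χ (A τ y)) μ ν z = χ (sgnSum₂ T V A μ ν z) := by
  simp only [sgnSum₂, mapCfg, R_map hl hr, lin_add_rev, lin_neg_rev, lin_sub_rev]

/-- Slot 3 of the sign sums. [folklore] [cite: Balaban1985BackgroundPropagators, (3.10) p.392] -/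
theorem sgnSum₃_map (V : ι → S → Bˣ) (A : ι → S → B) (μ ν : ι) (z : S) :
    sgnSum₃ T (mapCfg ψ V) (fun τ y => χ (A τ y)) μ ν z = χ (sgnSum₃ T V A μ ν z) := by
  simp only [sgnSum₃, mapCfg, R_map hl hr, lin_add_rev, lin_neg_rev, lin_sub_rev]

/-- Slot 4 of the sign sums. [folklore] [cite: Balaban1985BackgroundPropagators, (3.10) p.392] -/
theorem sgnSum₄_map (V : ι → S → Bˣ) (A : ι → S → B) (μ ν : ι) (z : S) :
    sgnSum₄ T (mapCfg ψ V) (fun τ y => χ (A τ y)) μ ν z = χ (sgnSum₄ T V A μ ν z) := by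
  simp only [sgnSum₄, mapCfg, R_map hl hr, lin_add_rev, lin_neg_rev]

/-- The commutator letter functions of `Δ′` are natural (slot 1). [folklore] [cite: Balaban1985BackgroundPropagators, (3.10) p.392] -/
theorem commG₁_map_fun (V : ι → S → Bˣ) (η : ℝ) (A : ι → S → B) :
    commG₁ T (mapCfg ψ V) η (fun τ y => χ (A τ y)) = fun μ ν z => χ (commG₁ T V η A μ ν z) := by
  funext μ ν z
  simp only [commG₁, sgnSum₁_map T hl hr, yP_map, mul_left_rev hl, mul_right_rev hr, lin_sub_rev, lin_smul_rev]

/-- The commutator letter functions of `Δ′` are natural (slot 2). [folklore] [cite: Balaban1985BackgroundPropagators, (3.10) p.392] -/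
theorem commG₂_map_fun (V : ι → S → Bˣ) (η : ℝ) (A : ι → S → B) :
    commG₂ T (mapCfg ψ V) η (fun τ y => χ (A τ y)) = fun μ ν z => χ (commG₂ T V η A μ ν z) := by
  funext μ ν z
  simp only [commG₂, sgnSum₂_map T hl hr, yP_map, mul_left_rev hl, mul_right_rev hr, lin_sub_rev, lin_smul_rev]

/-- The commutator letter functions of `Δ′` are natural (slot 3). [folklore] [cite: Balaban1985BackgroundPropagators, (3.10) p.392] -/
theorem commG₃_map_fun (V : ι → S → Bˣ) (η : ℝ) (A : ι → S → B) :
    commG₃ T (mapCfg ψ V) η (fun τ y => χ (A τ y)) = fun μ ν z => χ (commG₃ T V η A μ ν z) := by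
  funext μ ν z
  simp only [commG₃, sgnSum₃_map T hl hr, yP_map, mul_left_rev hl, mul_right_rev hr, lin_sub_rev, lin_smul_rev]

/-- The commutator letter functions of `Δ′` are natural (slot 4). [folklore] [cite: Balaban1985BackgroundPropagators, (3.10) p.392] -/
theorem commG₄_map_fun (V : ι → S → Bˣ) (η : ℝ) (A : ι → S → B) :
    commG₄ T (mapCfg ψ V) η (fun τ y => χ (A τ y)) = fun μ ν z => χ (commG₄ T V η A μ ν z) := by
  funext μ ν z
  simp only [commG₄, sgnSum₄_map T hl hr, yP_map, mul_left_rev hl, mul_right_rev hr, lin_sub_rev, lin_smul_rev]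

variable [Fintype ι] [LinearOrder ι]

/-- The plaquette adjoint `D*` of (3.9) is natural. [folklore] [cite: Balaban1985BackgroundPropagators, (3.9) p.392] -/
theorem divP_map (V : ι → S → Bˣ) (F : ι → ι → S → B) (μ : ι) (z : S) :
    divP T (mapCfg ψ V) (fun κ ν y => χ (F κ ν y)) μ z = χ (divP T V F μ z) := by
  simp only [divP, covDstar_map T hl hr, lin_ite_rev, lin_sum_rev, lin_sub_rev]

/-- The letter divergence is natural. [folklore] [cite: Balaban1985BackgroundPropagators, (3.10) p.392] -/
theorem divL_map (V : ι → S → Bˣ) (G₁ G₂ G₃ G₄ : ι → ι → S → B) (μ : ι) (z : S) :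
    divL T (mapCfg ψ V) (fun κ ν y => χ (G₁ κ ν y)) (fun κ ν y => χ (G₂ κ ν y)) (fun κ ν y => χ (G₃ κ ν y))
        (fun κ ν y => χ (G₄ κ ν y)) μ z = χ (divL T V G₁ G₂ G₃ G₄ μ z) := by
  simp only [divL, mapCfg, ← map_inv, R_map hl hr, lin_ite_rev, lin_sum_rev, lin_sub_rev]

/-- **`Δ′` IS NATURAL**: `(Δ′(ψV)(χA′))(b) = χ((Δ′(V)A′)(b))`. [folklore] [cite: Balaban1985BackgroundPropagators, (3.10) p.392] -/
theorem deltaPrimeOp_map (V : ι → S → Bˣ) (η : ℝ) (A : ι → S → B) (μ : ι) (z : S) :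
    deltaPrimeOp T (mapCfg ψ V) η (fun τ y => χ (A τ y)) μ z = χ (deltaPrimeOp T V η A μ z) := by
  simp only [deltaPrimeOp, jordanF_map_fun T hl hr, commG₁_map_fun T hl hr, commG₂_map_fun T hl hr, commG₃_map_fun T hl hr,
    commG₄_map_fun T hl hr, divP_map T hl hr, divL_map T hl hr, lin_add_rev]

omit [LinearOrder ι] in
/-- **`D*D` IS NATURAL**. [folklore] [cite: Balaban1985BackgroundPropagators, (3.71) p.404] -/
theorem lapDD_map (V : ι → S → Bˣ) (A : ι → S → B) (μ : ι) (z : S) :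
    lapDD T (mapCfg ψ V) (fun τ y => χ (A τ y)) μ z = χ (lapDD T V A μ z) := by
  simp only [lapDD, curl_map_fun T hl hr, covDstar_map T hl hr, lin_sum_rev]

omit [LinearOrder ι] in
/-- **`DD*` IS NATURAL**. [folklore] [cite: Balaban1985BackgroundPropagators, (3.75) p.405] -/
theorem gradDiv_map (V : ι → S → Bˣ) (A : ι → S → B) (μ : ι) (z : S) :
    gradDiv T (mapCfg ψ V) (fun τ y => χ (A τ y)) μ z = χ (gradDiv T V A μ z) := by
  simp only [gradDiv, covDstar_map_fun T hl hr, covD_map T hl hr, lin_sum_rev]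

variable [CompleteSpace B] [CompleteSpace B']

omit [Fintype ι] [LinearOrder ι] hl hr in
/-- **`U′U` IS NATURAL** for CONTINUOUS `ψ`: `ψ(e^{iηA(b′)}U(b′)) = e^{iηψ(A(b′))}ψ(U(b′))` (`map_exp_of_continuous`). [folklore]
[cite: Balaban1985BackgroundPropagators, p.396 before (3.37)] -/
theorem prodCfg_map (hψ : Continuous ψ) (U : ι → S → Bˣ) (η : ℝ) (A : ι → S → B) :
    prodCfg (mapCfg ψ U) η (fun τ y => ψ (A τ y)) = mapCfg ψ (prodCfg U η A) := by
  funext κ z; ext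
  simp only [val_prodCfg, val_mapCfg, map_mul, map_exp_of_continuous ψ hψ, map_smul]

/-- `Δ′(U′U)` is natural (in `U`, the exponent field `A` and the test field). [folklore] [cite: Balaban1985BackgroundPropagators, (3.82) p.407] -/
theorem deltaPrimeOp_prodCfg_map (hψ : Continuous ψ) (U : ι → S → Bˣ) (η : ℝ) (A A' : ι → S → B) (μ : ι) (z : S) :
    deltaPrimeOp T (prodCfg (mapCfg ψ U) η (fun τ y => ψ (A τ y))) η (fun τ y => χ (A' τ y)) μ z
      = χ (deltaPrimeOp T (prodCfg U η A) η A' μ z) := by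
  rw [prodCfg_map hψ]; exact deltaPrimeOp_map T hl hr _ η A' μ z

omit [LinearOrder ι] in
/-- `D*_{U′U}D_{U′U}` is natural. [folklore] [cite: Balaban1985BackgroundPropagators, (3.71) p.404] -/
theorem lapDD_prodCfg_map (hψ : Continuous ψ) (U : ι → S → Bˣ) (η : ℝ) (A A' : ι → S → B) (μ : ι) (z : S) :
    lapDD T (prodCfg (mapCfg ψ U) η (fun τ y => ψ (A τ y))) (fun τ y => χ (A' τ y)) μ z
      = χ (lapDD T (prodCfg U η A) A' μ z) := by
  rw [prodCfg_map hψ]; exact lapDD_map T hl hr _ A' μ z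

omit [LinearOrder ι] in
/-- `D_{U′U}D*_{U′U}` is natural. [folklore] [cite: Balaban1985BackgroundPropagators, (3.75) p.405] -/
theorem gradDiv_prodCfg_map (hψ : Continuous ψ) (U : ι → S → Bˣ) (η : ℝ) (A A' : ι → S → B) (μ : ι) (z : S) :
    gradDiv T (prodCfg (mapCfg ψ U) η (fun τ y => ψ (A τ y))) (fun τ y => χ (A' τ y)) μ z
      = χ (gradDiv T (prodCfg U η A) A' μ z) := by
  rw [prodCfg_map hψ]; exact gradDiv_map T hl hr _ A' μ z

omit [LinearOrder ι] in
/-- **`V₁(A)` IS NATURAL**. [folklore] [cite: Balaban1985BackgroundPropagators, (3.71) p.404] -/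
theorem V₁op_map (hψ : Continuous ψ) (U : ι → S → Bˣ) (η : ℝ) (A A' : ι → S → B) (μ : ι) (z : S) :
    V₁op T (mapCfg ψ U) η (fun τ y => ψ (A τ y)) (fun τ y => χ (A' τ y)) μ z = χ (V₁op T U η A A' μ z) := by
  simp only [V₁op_eq_lapDD_sub, prodCfg_map hψ, lapDD_map T hl hr, lin_sub_rev]

omit [LinearOrder ι] in
/-- **`V₂(A)` IS NATURAL**. [folklore] [cite: Balaban1985BackgroundPropagators, (3.75) p.405] -/
theorem V₂op_map (hψ : Continuous ψ) (U : ι → S → Bˣ) (η : ℝ) (A A' : ι → S → B) (μ : ι) (z : S) :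
    V₂op T (mapCfg ψ U) η (fun τ y => ψ (A τ y)) (fun τ y => χ (A' τ y)) μ z = χ (V₂op T U η A A' μ z) := by
  simp only [V₂op_eq_gradDiv_sub, prodCfg_map hψ, gradDiv_map T hl hr, lin_sub_rev]

/-- **`V₃(A)` IS NATURAL**: `(V₃^{ψU}(ψA)(χA′))(b) = χ((V₃^{U}(A)A′)(b))`. [folklore] [cite: Balaban1985BackgroundPropagators, (3.82) p.407] -/
theorem V₃val_map (hψ : Continuous ψ) (U : ι → S → Bˣ) (η : ℝ) (A A' : ι → S → B) (μ : ι) (z : S) :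
    V₃val T (mapCfg ψ U) η (fun τ y => ψ (A τ y)) (fun τ y => χ (A' τ y)) μ z = χ (V₃val T U η A A' μ z) := by
  simp only [V₃val_eq, V₁op_map T hl hr hψ, V₂op_map T hl hr hψ, prodCfg_map hψ, deltaPrimeOp_map T hl hr, lin_sub_rev,
    lin_add_rev, lin_smul_rev]

end Natural

/-! ## §2 The square-zero device

`𝔹 := 𝔸 ⋉ End(𝔸)` — Mathlib's `TrivSqZeroExt 𝔸 (𝔸 →L[ℂ] 𝔸)` with the bimodule structure `(c ▹ m)(a) = c·m(a)`, `(m ◃ c)(a) = m(a)·c`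
and the ℓ¹ norm — is a complete complex normed algebra (two bounded-action instances below, LOCAL to this file; everything else is
Mathlib's).  For `a ∈ 𝔸` the evaluation `Ψ_a : 𝔹 → 𝔸[ε] = TrivSqZeroExt 𝔸 𝔸`, `(c, m) ↦ (c, m(a))`, is a continuous algebra homomorphism,
and `(inl, inr) : 𝔸 → 𝔸[ε]` is a two-sided pair.  The UNIVERSAL TEST FIELD `Ξ_{κz} = (0, δ_{κz}·id)` turns a test-field-linear gadget
into its matrix entries: the `End`-component of `Γ^{𝔹}(inl U)(inl A)(Ξ_{κz})(μx)` is the operator `a ↦ Γ^{𝔸}(U)(A)(δ_{κz}a)(μx)`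
(`snd_apply_eq_of_natural`), and it depends analytically on `A` IN THE NORM OF `End(𝔸)` as soon as `Γ^{𝔹}` is (strongly) analytic in
its exponent field — which the lineage proved for every complete complex normed algebra, in particular for `𝔹`
(`analyticOnNhd_opNorm_of_device`). -/

section Device

variable {𝔸 : Type*} [NormedRing 𝔸] [NormedAlgebra ℂ 𝔸]

open TrivSqZeroExt MulOpposite

/-- `‖c ▹ m‖ ≤ ‖c‖‖m‖` for the left action `(c ▹ m)(a) = c·m(a)` of `𝔸` on `End(𝔸) = (𝔸 →L[ℂ] 𝔸)`. [folklore] -/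
private theorem norm_smul_End_le (c : 𝔸) (m : 𝔸 →L[ℂ] 𝔸) : ‖c • m‖ ≤ ‖c‖ * ‖m‖ := by
  refine ContinuousLinearMap.opNorm_le_bound _ (by positivity) fun a => ?_
  calc ‖(c • m) a‖ = ‖c * m a‖ := rfl
    _ ≤ ‖c‖ * ‖m a‖ := norm_mul_le _ _
    _ ≤ ‖c‖ * (‖m‖ * ‖a‖) := by gcongr; exact m.le_opNorm a
    _ = ‖c‖ * ‖m‖ * ‖a‖ := by ring

/-- `‖m ◃ c‖ ≤ ‖c‖‖m‖` for the right action `(m ◃ c)(a) = m(a)·c`. [folklore] -/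
private theorem norm_op_smul_End_le (c : 𝔸ᵐᵒᵖ) (m : 𝔸 →L[ℂ] 𝔸) : ‖c • m‖ ≤ ‖c‖ * ‖m‖ := by
  refine ContinuousLinearMap.opNorm_le_bound _ (by positivity) fun a => ?_
  calc ‖(c • m) a‖ = ‖m a * c.unop‖ := rfl
    _ ≤ ‖m a‖ * ‖c.unop‖ := norm_mul_le _ _
    _ ≤ (‖m‖ * ‖a‖) * ‖c.unop‖ := by gcongr; exact m.le_opNorm a
    _ = ‖c‖ * ‖m‖ * ‖a‖ := by rw [MulOpposite.norm_unop]; ring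

/-- The left action of `𝔸` on `End(𝔸)` is bounded (used as a LOCAL instance only). [folklore] -/
private theorem isBoundedSMul_End : IsBoundedSMul 𝔸 (𝔸 →L[ℂ] 𝔸) := IsBoundedSMul.of_norm_smul_le norm_smul_End_le

/-- The right action of `𝔸` on `End(𝔸)` is bounded (used as a LOCAL instance only). [folklore] -/
private theorem isBoundedSMul_End_op : IsBoundedSMul 𝔸ᵐᵒᵖ (𝔸 →L[ℂ] 𝔸) := IsBoundedSMul.of_norm_smul_le norm_op_smul_End_le

attribute [local instance] isBoundedSMul_End isBoundedSMul_End_op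

/-- `𝔹 = 𝔸 ⋉ End(𝔸)` (local notation). -/
local notation "𝔹" => TrivSqZeroExt 𝔸 (𝔸 →L[ℂ] 𝔸)
/-- `𝔻 = 𝔸[ε]`, the dual numbers over `𝔸` (local notation). -/
local notation "𝔻" => TrivSqZeroExt 𝔸 𝔸

/-- `𝔹` is a complex normed algebra, complete when `𝔸` is (Mathlib's ℓ¹ structure on the square-zero extension). -/
example : NormedAlgebra ℂ 𝔹 := inferInstance
example [CompleteSpace 𝔸] : CompleteSpace 𝔹 := inferInstance
example : NormedAlgebra ℂ 𝔻 := inferInstance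

/-- [folklore] -/
@[simp] private theorem inlAlgHom_apply' (M : Type*) [AddCommGroup M] [Module 𝔸 M] [Module 𝔸ᵐᵒᵖ M] [Module ℂ M]
    [SMulCommClass 𝔸 𝔸ᵐᵒᵖ M] [IsScalarTower ℂ 𝔸 M] [IsScalarTower ℂ 𝔸ᵐᵒᵖ M] (r : 𝔸) :
    TrivSqZeroExt.inlAlgHom ℂ 𝔸 M r = inl r := rfl

/-- `inl : 𝔸 → 𝔹` as a continuous `ℂ`-linear map. [folklore] -/
def inlL : 𝔸 →L[ℂ] 𝔹 where
  toFun := inl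
  map_add' r₁ r₂ := TrivSqZeroExt.ext rfl (by simp)
  map_smul' c r := inl_smul (𝔸 →L[ℂ] 𝔸) c r
  cont := TrivSqZeroExt.continuous_inl

/-- [folklore] -/
@[simp] private theorem inlL_apply (r : 𝔸) : inlL r = (inl r : 𝔹) := rfl

/-- `snd : 𝔹 → End(𝔸)` as a continuous `ℂ`-linear map. [folklore] -/
def sndL : 𝔹 →L[ℂ] (𝔸 →L[ℂ] 𝔸) where
  toFun := snd
  map_add' w₁ w₂ := snd_add w₁ w₂
  map_smul' c w := snd_smul c w
  cont := TrivSqZeroExt.continuous_snd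

/-- [folklore] -/
@[simp] private theorem sndL_apply (w : 𝔹) : sndL w = w.snd := rfl

/-- `inr : 𝔸 → 𝔸[ε]` as a `ℂ`-linear map. [folklore] -/
def inrD : 𝔸 →ₗ[ℂ] 𝔻 where
  toFun := inr
  map_add' m₁ m₂ := inr_add 𝔸 m₁ m₂
  map_smul' c m := inr_smul 𝔸 c m

/-- [folklore] -/
@[simp] private theorem inrD_apply (m : 𝔸) : inrD m = (inr m : 𝔻) := rfl

/-- Evaluation at `a` on the operator component: `m ↦ inr (m a)`. [folklore] -/
def evalInr (a : 𝔸) : (𝔸 →L[ℂ] 𝔸) →ₗ[ℂ] 𝔻 where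
  toFun m := inr (m a)
  map_add' m₁ m₂ := inr_add 𝔸 (m₁ a) (m₂ a)
  map_smul' c m := inr_smul 𝔸 c (m a)

/-- [folklore] -/
@[simp] private theorem evalInr_apply (a : 𝔸) (m : 𝔸 →L[ℂ] 𝔸) : evalInr a m = (inr (m a) : 𝔻) := rfl

/-- **THE EVALUATION HOMOMORPHISM** `Ψ_a : 𝔹 → 𝔸[ε]`, `(c, m) ↦ (c, m(a))` — an algebra homomorphism because `(c ▹ m)(a) = c·m(a)`,
`(m ◃ c)(a) = m(a)·c` and `ε² = 0` (Mathlib's universal property `TrivSqZeroExt.lift`). [folklore] -/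
def Ψ (a : 𝔸) : 𝔹 →ₐ[ℂ] 𝔻 :=
  TrivSqZeroExt.lift (TrivSqZeroExt.inlAlgHom ℂ 𝔸 𝔸) (evalInr a)
    (fun m₁ m₂ => inr_mul_inr 𝔸 _ _)
    (fun r m => by change inr ((r • m) a) = (inl r : 𝔻) * inr (m a); rw [inl_mul_inr]; rfl)
    (fun r m => by change inr ((op r • m) a) = (inr (m a) : 𝔻) * inl r; rw [inr_mul_inl]; rfl)

/-- `Ψ_a(c, m) = (c, m(a))`. [folklore] -/
private theorem Ψ_apply (a : 𝔸) (w : 𝔹) : Ψ a w = inl w.fst + inr (w.snd a) := TrivSqZeroExt.lift_def _ _ _ _ _ w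

/-- [folklore] -/
@[simp] private theorem Ψ_inl (a r : 𝔸) : Ψ a (inl r) = inl r := by
  rw [Ψ_apply]; simp

/-- [folklore] -/
@[simp] private theorem Ψ_inr (a : 𝔸) (m : 𝔸 →L[ℂ] 𝔸) : Ψ a (inr m) = inr (m a) := by
  rw [Ψ_apply]; simp

/-- `snd (Ψ_a w) = (snd w)(a)`. [folklore] -/
@[simp] private theorem snd_Ψ (a : 𝔸) (w : 𝔹) : (Ψ a w).snd = w.snd a := by
  rw [Ψ_apply]; simp

/-- `Ψ_a` is continuous. [folklore] -/
private theorem continuous_Ψ (a : 𝔸) : Continuous (Ψ a) := by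
  have : (Ψ a : 𝔹 → 𝔻) = fun w => inl w.fst + inr (w.snd a) := funext (Ψ_apply a)
  rw [this]
  exact (TrivSqZeroExt.continuous_inl.comp TrivSqZeroExt.continuous_fst).add
    (TrivSqZeroExt.continuous_inr.comp ((ContinuousLinearMap.apply ℂ 𝔸 a).continuous.comp TrivSqZeroExt.continuous_snd))

/-- `(inl, inr) : 𝔸 → 𝔸[ε]` is a two-sided pair (left): `inr(ts) = inl(t)inr(s)`. [folklore] -/
private theorem inl_inr_left : ∀ t s : 𝔸, inrD (t * s) = TrivSqZeroExt.inlAlgHom ℂ 𝔸 𝔸 t * inrD s := fun t s => by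
  rw [inlAlgHom_apply', inrD_apply, inrD_apply, inl_mul_inr, smul_eq_mul]

/-- `(inl, inr) : 𝔸 → 𝔸[ε]` is a two-sided pair (right): `inr(st) = inr(s)inl(t)`. [folklore] -/
private theorem inl_inr_right : ∀ s t : 𝔸, inrD (s * t) = inrD s * TrivSqZeroExt.inlAlgHom ℂ 𝔸 𝔸 t := fun s t => by
  rw [inlAlgHom_apply', inrD_apply, inrD_apply, inr_mul_inl, op_smul_eq_mul]

variable {S ι : Type*}

/-- `Ψ_a ∘ inl_𝔹 = inl_{𝔸[ε]}` on configurations. [folklore] -/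
private theorem mapCfg_Ψ (a : 𝔸) (U : ι → S → 𝔸ˣ) :
    mapCfg (Ψ a) (mapCfg (TrivSqZeroExt.inlAlgHom ℂ 𝔸 (𝔸 →L[ℂ] 𝔸)) U)
      = mapCfg (TrivSqZeroExt.inlAlgHom ℂ 𝔸 𝔸) U := by
  funext κ z; ext <;> simp

/-- `A ↦ (inl A(b′))_{b′}`: the field pushed into `𝔹`, as a continuous linear map of field spaces. [folklore] -/
def inlFL : (ι → S → 𝔸) →L[ℂ] (ι → S → 𝔹) :=
  ContinuousLinearMap.pi fun τ => ContinuousLinearMap.pi fun y =>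
    inlL.comp ((ContinuousLinearMap.proj (R := ℂ) (φ := fun _ : S => 𝔸) y).comp
      (ContinuousLinearMap.proj (R := ℂ) (φ := fun _ : ι => S → 𝔸) τ))

/-- [folklore] -/
@[simp] private theorem inlFL_apply (A : ι → S → 𝔸) (τ : ι) (y : S) : inlFL A τ y = (inl (A τ y) : 𝔹) := rfl

/-- `A′ ↦ A′(κz)` as a continuous linear map. [folklore] -/
def projL (κ : ι) (z : S) : (ι → S → 𝔸) →L[ℂ] 𝔸 :=
  (ContinuousLinearMap.proj (R := ℂ) (φ := fun _ : S => 𝔸) z).comp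
    (ContinuousLinearMap.proj (R := ℂ) (φ := fun _ : ι => S → 𝔸) κ)

/-- [folklore] -/
@[simp] private theorem projL_apply (κ : ι) (z : S) (A : ι → S → 𝔸) : projL (𝔸 := 𝔸) κ z A = A κ z := rfl

variable [DecidableEq ι] [DecidableEq S]

/-- **THE UNIVERSAL TEST FIELD** at the bond `(κ, z)`: `(0, id)` there, `0` elsewhere. [folklore] -/
def Ξ (κ : ι) (z : S) : ι → S → 𝔹 :=
  fun τ y => inr ((Pi.single κ (Pi.single z (ContinuousLinearMap.id ℂ 𝔸)) : ι → S → (𝔸 →L[ℂ] 𝔸)) τ y)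

/-- [folklore] -/
private theorem single₂_id_apply (κ : ι) (z : S) (a : 𝔸) (τ : ι) (y : S) :
    (Pi.single κ (Pi.single z (ContinuousLinearMap.id ℂ 𝔸)) : ι → S → (𝔸 →L[ℂ] 𝔸)) τ y a
      = (Pi.single κ (Pi.single z a) : ι → S → 𝔸) τ y := by
  by_cases h₁ : τ = κ
  · subst h₁
    by_cases h₂ : y = z
    · subst h₂; simp
    · simp [h₂]
  · simp [h₁]

/-- `Ψ_a(Ξ_{κz}) = inr(δ_{κz}·a)`: evaluating the universal test field at `a` gives the point test field `δ_{κz}a`. [folklore] -/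
@[simp] private theorem Ψ_Ξ (a : 𝔸) (κ : ι) (z : S) (τ : ι) (y : S) :
    Ψ a (Ξ κ z τ y) = inr ((Pi.single κ (Pi.single z a) : ι → S → 𝔸) τ y) := by
  simp only [Ξ, Ψ_inr, single₂_id_apply]

/-- `a ↦ δ_{μx}·a` as a continuous linear map into the field space. [folklore] -/
def embedL (μ : ι) (x : S) : 𝔸 →L[ℂ] (ι → S → 𝔸) :=
  (ContinuousLinearMap.single ℂ (fun _ : ι => S → 𝔸) μ).comp (ContinuousLinearMap.single ℂ (fun _ : S => 𝔸) x)

/-- [folklore] -/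
@[simp] private theorem embedL_apply (μ : ι) (x : S) (a : 𝔸) :
    embedL (ι := ι) (S := S) μ x a = (Pi.single μ (Pi.single x a) : ι → S → 𝔸) := by
  simp [embedL]

/-- **MATRIX ENTRIES FROM THE DEVICE.**  Let `k^{𝔸}`, `k^{𝔹}`, `k^{𝔸[ε]}` be the three coefficient versions of a gadget
`(A, A′, b) ↦ k(A)(A′)(b)` (configurations `U`, `inl U`, `inl U` fixed inside), natural along `Ψ_a` (h₁) and along `(inl, inr)` (h₂).  Then the
`End`-component of `k^{𝔹}(inl A)(Ξ_{κz})(μx)`, evaluated at `a`, is `k^{𝔸}(A)(δ_{κz}a)(μx)` — the proof device for the operator-norm reading of «depend analytically on A» (p. 407).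
[folklore] [cite: Balaban1985BackgroundPropagators, p.407 after (3.83)] -/
theorem snd_apply_eq_of_natural
    (k𝔸 : (ι → S → 𝔸) → (ι → S → 𝔸) → ι → S → 𝔸)
    (k𝔹 : (ι → S → 𝔹) → (ι → S → 𝔹) → ι → S → 𝔹)
    (k𝔻 : (ι → S → 𝔻) → (ι → S → 𝔻) → ι → S → 𝔻)
    (h₁ : ∀ (a : 𝔸) (A Ξ' : ι → S → 𝔹) (μ : ι) (x : S),
      k𝔻 (fun τ y => Ψ a (A τ y)) (fun τ y => Ψ a (Ξ' τ y)) μ x = Ψ a (k𝔹 A Ξ' μ x))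
    (h₂ : ∀ (A A' : ι → S → 𝔸) (μ : ι) (x : S),
      k𝔻 (fun τ y => inl (A τ y)) (fun τ y => inr (A' τ y)) μ x = inr (k𝔸 A A' μ x))
    (κ : ι) (z : S) (μ : ι) (x : S) (A : ι → S → 𝔸) (a : 𝔸) :
    (k𝔹 (inlFL A) (Ξ κ z) μ x).snd a = k𝔸 A (Pi.single κ (Pi.single z a)) μ x := by
  have e₁ := h₁ a (inlFL A) (Ξ κ z) μ x
  simp only [inlFL_apply, Ψ_inl, Ψ_Ξ] at e₁
  have e₂ := congrArg TrivSqZeroExt.snd (e₁.symm.trans (h₂ A (Pi.single κ (Pi.single z a)) μ x))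
  rwa [snd_Ψ, snd_inr] at e₂

variable [Fintype ι] [Fintype S]

omit [NormedAlgebra ℂ 𝔸] in
/-- `Σ_{μx} δ_{μx}·g(μx) = g`. [folklore] -/
private theorem sum_single_single (g : ι → S → 𝔸) :
    ∑ μ, ∑ x, (Pi.single μ (Pi.single x (g μ x)) : ι → S → 𝔸) = g := by
  funext τ y
  simp only [Finset.sum_apply]
  rw [Finset.sum_eq_single_of_mem τ (Finset.mem_univ τ) fun μ _ hμ => by simp [Pi.single_eq_of_ne' hμ]]
  rw [Finset.sum_eq_single_of_mem y (Finset.mem_univ y) fun x _ hx => by simp [Pi.single_eq_of_ne' hx]]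
  simp

/-- **OPERATOR-NORM ANALYTICITY FROM THE DEVICE.**  If `K(A) ∈ 𝓛(field space)` has matrix entries given by the device
(`(snd k^{𝔹}(inl A)(Ξ_{κz})(μx))(a) = (K(A)δ_{κz}a)(μx)`) and `A ↦ k^{𝔹}(A)(Ξ′)(μx)` is analytic on the field space over `𝔹` for every test
field `Ξ′`, then `A ↦ K(A)` is analytic as a map into `𝓛(field space)` WITH THE OPERATOR NORM: `K(A) = Σ_{κz,μx} δ_{μx} ∘ snd(k^{𝔹}(inl A)(Ξ_{κz})(μx)) ∘ ev_{κz}`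
is a finite sum of compositions of fixed continuous linear maps with `End(𝔸)`-valued analytic maps — the proof device for the operator-norm reading of «The operators V₃(A), P₁(A), P₂(A)
depend analytically on A in the domain (3.37)» (p. 407). [folklore] [cite: Balaban1985BackgroundPropagators, p.407 after (3.83)] -/
theorem analyticOnNhd_opNorm_of_device (K : (ι → S → 𝔸) → ((ι → S → 𝔸) →L[ℂ] (ι → S → 𝔸)))
    (k𝔹 : (ι → S → 𝔹) → (ι → S → 𝔹) → ι → S → 𝔹)
    (hentry : ∀ (κ : ι) (z : S) (μ : ι) (x : S) (A : ι → S → 𝔸) (a : 𝔸),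
      (k𝔹 (inlFL A) (Ξ κ z) μ x).snd a = K A (Pi.single κ (Pi.single z a)) μ x)
    (hk : ∀ (Ξ' : ι → S → 𝔹) (μ : ι) (x : S), AnalyticOnNhd ℂ (fun A : ι → S → 𝔹 => k𝔹 A Ξ' μ x) Set.univ) :
    AnalyticOnNhd ℂ K Set.univ := by
  intro A₀ _
  have e : K = fun A => ∑ κ, ∑ z, ∑ μ, ∑ x, (embedL μ x).comp ((sndL (k𝔹 (inlFL A) (Ξ κ z) μ x)).comp (projL κ z)) := by
    funext A; ext1 A'
    simp only [FunLike.coe_sum, Finset.sum_apply, ContinuousLinearMap.comp_apply, projL_apply, sndL_apply, hentry,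
      embedL_apply]
    simp_rw [sum_single_single, ← map_sum]
    rw [sum_single_single]
  rw [e]
  refine Finset.analyticAt_fun_sum _ fun κ _ => Finset.analyticAt_fun_sum _ fun z _ =>
    Finset.analyticAt_fun_sum _ fun μ _ => Finset.analyticAt_fun_sum _ fun x _ => ?_
  have e' : (fun A : ι → S → 𝔸 => (embedL μ x).comp ((sndL (k𝔹 (inlFL A) (Ξ κ z) μ x)).comp (projL κ z)))
      = (ContinuousLinearMap.compL ℂ (ι → S → 𝔸) 𝔸 (ι → S → 𝔸) (embedL μ x))
          ∘ ((ContinuousLinearMap.compL ℂ (ι → S → 𝔸) 𝔸 𝔸).flip (projL κ z))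
          ∘ sndL ∘ (fun A : ι → S → 𝔹 => k𝔹 A (Ξ κ z) μ x) ∘ inlFL := by
    funext A; simp [ContinuousLinearMap.compL_apply, ContinuousLinearMap.flip_apply]
  rw [e']
  exact (ContinuousLinearMap.analyticAt _ _).comp <| (ContinuousLinearMap.analyticAt _ _).comp <|
    (ContinuousLinearMap.analyticAt _ _).comp <| (hk (Ξ κ z) μ x _ trivial).comp (ContinuousLinearMap.analyticAt _ _)

end Device

/-! ## §3 The operators of (3.82) depend analytically on `A` in operator norm -/

section OpNorm

variable {𝔸 : Type*} [NormedRing 𝔸] [NormedAlgebra ℂ 𝔸] [CompleteSpace 𝔸] {S ι : Type*}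
variable [Fintype ι] [Fintype S] [LinearOrder ι]
variable (T : ι → Equiv.Perm S) (U : ι → S → 𝔸ˣ)

open TrivSqZeroExt

attribute [local instance] isBoundedSMul_End isBoundedSMul_End_op

/-- **`V₃(A)` DEPENDS ANALYTICALLY ON `A` IN OPERATOR NORM** — B9 p. 407 «The operators V₃(A), P₁(A), P₂(A) depend analytically on A in
the domain (3.37)», for `V₃`, in the strongest reading on a finite lattice: `A ↦ V₃(A) ∈ 𝓛(field space)` (`B9Eq382V3Operator.V₃L`, the
sup-normed field space, operator norm on `𝓛`) is ENTIRE. [folklore] [cite: Balaban1985BackgroundPropagators, p.407 after (3.83), (3.82) p.407] -/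
theorem analyticOnNhd_V₃L (η : ℝ) : AnalyticOnNhd ℂ (fun A : ι → S → 𝔸 => V₃L T U η A) Set.univ := by
  classical
  exact analyticOnNhd_opNorm_of_device (fun A => V₃L T U η A)
    (fun A Ξ' μ x => V₃val T (mapCfg (TrivSqZeroExt.inlAlgHom ℂ 𝔸 (𝔸 →L[ℂ] 𝔸)) U) η A Ξ' μ x)
    (fun κ z μ x A a => by
      rw [V₃L_apply]
      exact snd_apply_eq_of_natural (fun A A' μ x => V₃val T U η A A' μ x)
        (fun A Ξ' μ x => V₃val T (mapCfg (TrivSqZeroExt.inlAlgHom ℂ 𝔸 (𝔸 →L[ℂ] 𝔸)) U) η A Ξ' μ x)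
        (fun A A' μ x => V₃val T (mapCfg (TrivSqZeroExt.inlAlgHom ℂ 𝔸 𝔸) U) η A A' μ x)
        (fun a A Ξ' μ x => by
          simpa [mapCfg_Ψ] using
            V₃val_map T (self_left (Ψ a)) (self_right (Ψ a)) (continuous_Ψ a) (mapCfg (TrivSqZeroExt.inlAlgHom ℂ 𝔸 _) U) η A Ξ' μ x)
        (fun A A' μ x => by
          simpa using V₃val_map T inl_inr_left inl_inr_right TrivSqZeroExt.continuous_inl U η A A' μ x)
        κ z μ x A a)
    (fun Ξ' μ x => analyticOnNhd_V₃val T _ η Ξ' μ x)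

/-- **`V₁(A)` IN OPERATOR NORM**: `A ↦ V₁(A)` (`B9Eq372Operator.V₁L`, the lineage's `η²`-scaled `V₁`) is entire as an `𝓛`-valued map.
[folklore] [cite: Balaban1985BackgroundPropagators, (3.71)–(3.73) pp.404–405] -/
theorem analyticOnNhd_V₁L (η : ℝ) : AnalyticOnNhd ℂ (fun A : ι → S → 𝔸 => V₁L T U η A) Set.univ := by
  classical
  exact analyticOnNhd_opNorm_of_device (fun A => V₁L T U η A)
    (fun A Ξ' μ x => V₁op T (mapCfg (TrivSqZeroExt.inlAlgHom ℂ 𝔸 (𝔸 →L[ℂ] 𝔸)) U) η A Ξ' μ x)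
    (fun κ z μ x A a => by
      rw [V₁L_apply]
      exact snd_apply_eq_of_natural (fun A A' μ x => V₁op T U η A A' μ x)
        (fun A Ξ' μ x => V₁op T (mapCfg (TrivSqZeroExt.inlAlgHom ℂ 𝔸 (𝔸 →L[ℂ] 𝔸)) U) η A Ξ' μ x)
        (fun A A' μ x => V₁op T (mapCfg (TrivSqZeroExt.inlAlgHom ℂ 𝔸 𝔸) U) η A A' μ x)
        (fun a A Ξ' μ x => by
          simpa [mapCfg_Ψ] using
            V₁op_map T (self_left (Ψ a)) (self_right (Ψ a)) (continuous_Ψ a) (mapCfg (TrivSqZeroExt.inlAlgHom ℂ 𝔸 _) U) η A Ξ' μ x)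
        (fun A A' μ x => by
          simpa using V₁op_map T inl_inr_left inl_inr_right TrivSqZeroExt.continuous_inl U η A A' μ x)
        κ z μ x A a)
    (fun Ξ' μ x => analyticOnNhd_V₁op T _ η Ξ' μ x)

/-- **`V₂(A)` IN OPERATOR NORM**: `A ↦ V₂(A)` (`B9Eq372Operator.V₂L`) is entire as an `𝓛`-valued map. [folklore]
[cite: Balaban1985BackgroundPropagators, (3.75) p.405] -/
theorem analyticOnNhd_V₂L (η : ℝ) : AnalyticOnNhd ℂ (fun A : ι → S → 𝔸 => V₂L T U η A) Set.univ := by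
  classical
  exact analyticOnNhd_opNorm_of_device (fun A => V₂L T U η A)
    (fun A Ξ' μ x => V₂op T (mapCfg (TrivSqZeroExt.inlAlgHom ℂ 𝔸 (𝔸 →L[ℂ] 𝔸)) U) η A Ξ' μ x)
    (fun κ z μ x A a => by
      rw [V₂L_apply]
      exact snd_apply_eq_of_natural (fun A A' μ x => V₂op T U η A A' μ x)
        (fun A Ξ' μ x => V₂op T (mapCfg (TrivSqZeroExt.inlAlgHom ℂ 𝔸 (𝔸 →L[ℂ] 𝔸)) U) η A Ξ' μ x)
        (fun A A' μ x => V₂op T (mapCfg (TrivSqZeroExt.inlAlgHom ℂ 𝔸 𝔸) U) η A A' μ x)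
        (fun a A Ξ' μ x => by
          simpa [mapCfg_Ψ] using
            V₂op_map T (self_left (Ψ a)) (self_right (Ψ a)) (continuous_Ψ a) (mapCfg (TrivSqZeroExt.inlAlgHom ℂ 𝔸 _) U) η A Ξ' μ x)
        (fun A A' μ x => by
          simpa using V₂op_map T inl_inr_left inl_inr_right TrivSqZeroExt.continuous_inl U η A A' μ x)
        κ z μ x A a)
    (fun Ξ' μ x => analyticOnNhd_V₂op T _ η Ξ' μ x)

/-- **`Δ′(U′U)` IN OPERATOR NORM**: `A ↦ Δ′(e^{iηA}U) ∈ 𝓛(field space)` (`B9Eq382V3Operator.deltaPrimeL`) is entire. [folklore]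
[cite: Balaban1985BackgroundPropagators, p.404 after (3.69), (3.82) p.407] -/
theorem analyticOnNhd_deltaPrimeL_prodCfg (η : ℝ) :
    AnalyticOnNhd ℂ (fun A : ι → S → 𝔸 => deltaPrimeL T (prodCfg U η A) η) Set.univ := by
  classical
  exact analyticOnNhd_opNorm_of_device (fun A => deltaPrimeL T (prodCfg U η A) η)
    (fun A Ξ' μ x => deltaPrimeOp T (prodCfg (mapCfg (TrivSqZeroExt.inlAlgHom ℂ 𝔸 (𝔸 →L[ℂ] 𝔸)) U) η A) η Ξ' μ x)
    (fun κ z μ x A a => by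
      rw [deltaPrimeL_apply]
      exact snd_apply_eq_of_natural (fun A A' μ x => deltaPrimeOp T (prodCfg U η A) η A' μ x)
        (fun A Ξ' μ x => deltaPrimeOp T (prodCfg (mapCfg (TrivSqZeroExt.inlAlgHom ℂ 𝔸 (𝔸 →L[ℂ] 𝔸)) U) η A) η Ξ' μ x)
        (fun A A' μ x => deltaPrimeOp T (prodCfg (mapCfg (TrivSqZeroExt.inlAlgHom ℂ 𝔸 𝔸) U) η A) η A' μ x)
        (fun a A Ξ' μ x => by
          simpa [mapCfg_Ψ] using deltaPrimeOp_prodCfg_map T (self_left (Ψ a)) (self_right (Ψ a)) (continuous_Ψ a)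
            (mapCfg (TrivSqZeroExt.inlAlgHom ℂ 𝔸 _) U) η A Ξ' μ x)
        (fun A A' μ x => by
          simpa using deltaPrimeOp_prodCfg_map T inl_inr_left inl_inr_right TrivSqZeroExt.continuous_inl U η A A' μ x)
        κ z μ x A a)
    (fun Ξ' μ x => analyticOnNhd_deltaPrimeOp_prodCfg T _ η Ξ' μ x)

/-- **`D*_{U′U}D_{U′U}` IN OPERATOR NORM**: `A ↦ D*_{U′U}D_{U′U}` (`B9Eq372Operator.lapDDL` at `U′U`) is entire. [folklore]
[cite: Balaban1985BackgroundPropagators, (3.71) p.404] -/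
theorem analyticOnNhd_lapDDL_prodCfg (η : ℝ) :
    AnalyticOnNhd ℂ (fun A : ι → S → 𝔸 => lapDDL T (prodCfg U η A)) Set.univ := by
  classical
  exact analyticOnNhd_opNorm_of_device (fun A => lapDDL T (prodCfg U η A))
    (fun A Ξ' μ x => lapDD T (prodCfg (mapCfg (TrivSqZeroExt.inlAlgHom ℂ 𝔸 (𝔸 →L[ℂ] 𝔸)) U) η A) Ξ' μ x)
    (fun κ z μ x A a => by
      rw [lapDDL_apply]
      exact snd_apply_eq_of_natural (fun A A' μ x => lapDD T (prodCfg U η A) A' μ x)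
        (fun A Ξ' μ x => lapDD T (prodCfg (mapCfg (TrivSqZeroExt.inlAlgHom ℂ 𝔸 (𝔸 →L[ℂ] 𝔸)) U) η A) Ξ' μ x)
        (fun A A' μ x => lapDD T (prodCfg (mapCfg (TrivSqZeroExt.inlAlgHom ℂ 𝔸 𝔸) U) η A) A' μ x)
        (fun a A Ξ' μ x => by
          simpa [mapCfg_Ψ] using lapDD_prodCfg_map T (self_left (Ψ a)) (self_right (Ψ a)) (continuous_Ψ a)
            (mapCfg (TrivSqZeroExt.inlAlgHom ℂ 𝔸 _) U) η A Ξ' μ x)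
        (fun A A' μ x => by
          simpa using lapDD_prodCfg_map T inl_inr_left inl_inr_right TrivSqZeroExt.continuous_inl U η A A' μ x)
        κ z μ x A a)
    (fun Ξ' μ x => analyticOnNhd_lapDD_prodCfg T _ η Ξ' μ x)

/-- **`D_{U′U}D*_{U′U}` IN OPERATOR NORM**: `A ↦ D_{U′U}D*_{U′U}` (`B9Eq372Operator.gradDivL` at `U′U`) is entire. [folklore]
[cite: Balaban1985BackgroundPropagators, (3.75) p.405] -/
theorem analyticOnNhd_gradDivL_prodCfg (η : ℝ) :
    AnalyticOnNhd ℂ (fun A : ι → S → 𝔸 => gradDivL T (prodCfg U η A)) Set.univ := by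
  classical
  exact analyticOnNhd_opNorm_of_device (fun A => gradDivL T (prodCfg U η A))
    (fun A Ξ' μ x => gradDiv T (prodCfg (mapCfg (TrivSqZeroExt.inlAlgHom ℂ 𝔸 (𝔸 →L[ℂ] 𝔸)) U) η A) Ξ' μ x)
    (fun κ z μ x A a => by
      rw [gradDivL_apply]
      exact snd_apply_eq_of_natural (fun A A' μ x => gradDiv T (prodCfg U η A) A' μ x)
        (fun A Ξ' μ x => gradDiv T (prodCfg (mapCfg (TrivSqZeroExt.inlAlgHom ℂ 𝔸 (𝔸 →L[ℂ] 𝔸)) U) η A) Ξ' μ x)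
        (fun A A' μ x => gradDiv T (prodCfg (mapCfg (TrivSqZeroExt.inlAlgHom ℂ 𝔸 𝔸) U) η A) A' μ x)
        (fun a A Ξ' μ x => by
          simpa [mapCfg_Ψ] using gradDiv_prodCfg_map T (self_left (Ψ a)) (self_right (Ψ a)) (continuous_Ψ a)
            (mapCfg (TrivSqZeroExt.inlAlgHom ℂ 𝔸 _) U) η A Ξ' μ x)
        (fun A A' μ x => by
          simpa using gradDiv_prodCfg_map T inl_inr_left inl_inr_right TrivSqZeroExt.continuous_inl U η A A' μ x)
        κ z μ x A a)
    (fun Ξ' μ x => analyticOnNhd_gradDiv_prodCfg T _ η Ξ' μ x)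

/-- **`Δ(U′U) = η⁻²D*_{U′U}D_{U′U} + Δ′(U′U)` IN OPERATOR NORM** (`B9Eq382V3Operator.deltaL` at `U′U`). [folklore]
[cite: Balaban1985BackgroundPropagators, p.404 after (3.69)] -/
theorem analyticOnNhd_deltaL_prodCfg (η : ℝ) :
    AnalyticOnNhd ℂ (fun A : ι → S → 𝔸 => deltaL T (prodCfg U η A) η) Set.univ := fun A₀ _ => by
  -- `L ↦ η⁻²L = (η⁻²·1) ∘ L` is the continuous linear map `compL(η⁻²·1)` of `𝓛(field space)` (composition form)
  have e : (fun A : ι → S → 𝔸 => deltaL T (prodCfg U η A) η)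
      = fun A => (ContinuousLinearMap.compL ℂ (ι → S → 𝔸) (ι → S → 𝔸) (ι → S → 𝔸)
            ((((η : ℂ)⁻¹) ^ 2) • ContinuousLinearMap.id ℂ (ι → S → 𝔸))) (lapDDL T (prodCfg U η A))
          + deltaPrimeL T (prodCfg U η A) η := by
    funext A
    simp only [deltaL, ContinuousLinearMap.compL_apply, ContinuousLinearMap.smul_comp, ContinuousLinearMap.id_comp]
  rw [e]
  exact ((ContinuousLinearMap.analyticAt _ _).comp (analyticOnNhd_lapDDL_prodCfg T U η A₀ trivial)).fun_add
    (analyticOnNhd_deltaPrimeL_prodCfg T U η A₀ trivial)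

/-- **THE SECOND MEMBER OF (3.82) IN OPERATOR NORM**: `A ↦ (Δ + η⁻²DD*)(U′U)` (`B9Eq382V3Operator.dSumL` at `U′U`, `= (Δ + η⁻²DD*)(U) − V₃(A)` by
`eq382_V₃`) is entire. [folklore] [cite: Balaban1985BackgroundPropagators, (3.82) p.407] -/
theorem analyticOnNhd_dSumL_prodCfg (η : ℝ) :
    AnalyticOnNhd ℂ (fun A : ι → S → 𝔸 => dSumL T (prodCfg U η A) η) Set.univ := fun A₀ _ => by
  simp only [eq382_V₃]
  exact analyticAt_const.fun_sub (analyticOnNhd_V₃L T U η A₀ trivial)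

/-- **THE PRINTED SENTENCE FOR `V₃`, OPERATOR-NORM READING**: `A ↦ V₃(A)` is analytic, as an `𝓛(field space)`-valued map, on the domain
(3.37) (`B9Eq373V3Analytic.dom337`; restriction of the entire statement). [folklore]
[cite: Balaban1985BackgroundPropagators, p.407 after (3.83), (3.37) p.396] -/
theorem analyticOnNhd_V₃L_dom337 (η α₁ L : ℝ) (j : ℕ) :
    AnalyticOnNhd ℂ (fun A : ι → S → 𝔸 => V₃L T U η A) (dom337 T U η α₁ L j) :=
  (analyticOnNhd_V₃L T U η).mono (Set.subset_univ _)

/-- COROLLARY: `A ↦ V₃(A)` is complex-differentiable everywhere as an `𝓛`-valued map. [folklore]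
[cite: Balaban1985BackgroundPropagators, p.407 after (3.83)] -/
theorem differentiable_V₃L (η : ℝ) : Differentiable ℂ fun A : ι → S → 𝔸 => V₃L T U η A :=
  fun A => (analyticOnNhd_V₃L T U η A trivial).differentiableAt

/-- COROLLARY: `A ↦ V₃(A)` is continuous in operator norm. [folklore] [cite: Balaban1985BackgroundPropagators, p.407 after (3.83)] -/
theorem continuous_V₃L (η : ℝ) : Continuous fun A : ι → S → 𝔸 => V₃L T U η A :=
  (differentiable_V₃L T U η).continuous

/-- COROLLARY (matrix entries): for every pair of bonds the entry `a ↦ (V₃(A)δ_{κz}a)(μx) ∈ End(𝔸)` (`projL μ x ∘ V₃(A) ∘ embedL κ z`)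
is an entire function of `A` in the norm of `End(𝔸)`. [folklore] [cite: Balaban1985BackgroundPropagators, (3.82) p.407] -/
theorem analyticOnNhd_V₃L_entry [DecidableEq S] (η : ℝ) (κ : ι) (z : S) (μ : ι) (x : S) :
    AnalyticOnNhd ℂ (fun A : ι → S → 𝔸 => (projL μ x).comp ((V₃L T U η A).comp (embedL κ z))) Set.univ := fun A₀ _ => by
  have e : (fun A : ι → S → 𝔸 => (projL μ x).comp ((V₃L T U η A).comp (embedL κ z)))
      = (ContinuousLinearMap.compL ℂ 𝔸 (ι → S → 𝔸) 𝔸 (projL μ x))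
          ∘ ((ContinuousLinearMap.compL ℂ 𝔸 (ι → S → 𝔸) (ι → S → 𝔸)).flip (embedL κ z))
          ∘ (fun A : ι → S → 𝔸 => V₃L T U η A) := by
    funext A; simp [ContinuousLinearMap.compL_apply, ContinuousLinearMap.flip_apply]
  rw [e]
  exact (ContinuousLinearMap.analyticAt _ _).comp <| (ContinuousLinearMap.analyticAt _ _).comp (analyticOnNhd_V₃L T U η A₀ trivial)

end OpNorm

/-! ## §4 Sanity -/

section Sanity

variable {𝔸 : Type*} [NormedRing 𝔸] [NormedAlgebra ℂ 𝔸] [CompleteSpace 𝔸] {S ι : Type*}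
variable [Fintype ι] [Fintype S] [LinearOrder ι] (T : ι → Equiv.Perm S) (U : ι → S → 𝔸ˣ)

/-- At `A = 0` nothing is claimed beyond `V₃(0) = 0` (node `B9Eq382V3Operator.V₃L_zero`); the content of this file is the regularity of
`A ↦ V₃(A)`: e.g. it is differentiable at `0` in operator norm. -/
example (η : ℝ) : DifferentiableAt ℂ (fun A : ι → S → 𝔸 => V₃L T U η A) 0 := differentiable_V₃L T U η 0

/-- `mapCfg id = id`: naturality specialises to the identity. -/
example (V : ι → S → 𝔸ˣ) : mapCfg (AlgHom.id ℂ 𝔸) V = V := by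
  funext κ z; ext; simp

end Sanity

end Literature.MathematicalPhysics.QuantumFieldTheory.Balaban1983to89.B9Eq382V3NormAnalytic
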